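import Summits.Ventures.DiscreteObjects.UnitDistance.Sqrt2Sqrt3Local

/-!
# Step frames in `ℚ₂(i, √2, √3)`: four colours always, two colours in the ramified frames
(cell `pub-namedobj`, target (U), seat udg g11)

Framing (verbatim for the cell): lottery ticket; floor = certified bounds/negative ranges.

Local core of U2-COMPLETE (the full 2-adic criterion for real multiquadratic planes; PROP-U2.md of udg g3,
refereed on paper 2026-08-20; kernel so far only for square classes in `⟨[2],[3]⟩`, udg g10).  All four maximal
`[−1]`-free square-class groups `⟨[±2],[±3]⟩` of `ℚ₂^×/ℚ₂^{×2}` have the SAME local field `M = ℚ₂(i, √2, √3)`; what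
changes is the index-2 subfield `L = ℚ₂(g₁, g₂)`, `g₁ ∈ {s2, I·s2}`, `g₂ ∈ {s3, I·s3}`, in which the coordinates live.
A `Frame` of `LocalData23` records `g₁, g₂` (`g₁ ∈ ℚ₂(s2, I)`, `g₂² = c₂ ∈ ℚ₂`) and a `ℚ₂`-automorphism `α` negating
`I` and fixing `g₁, g₂`; a frame STEP is `u = X + I·Y` with `X, Y ∈ ℚ₂ ⊕ ℚ₂ g₁ ⊕ ℚ₂ g₂ ⊕ ℚ₂ g₁g₂`, `X² + Y² = 1`.

* `Frame.spN_step` — `‖u‖ = 1` (`u·αu = 1`, Galois invariance of the spectral norm);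
* `Frame.resid_step_cube` — `ū³ = 1` (`T = u + τu`, `N = u·τu` lie in `ℚ₂(s2, I) = ℚ₂(ζ₈)`, residues `0/1` by
  `Zeta8Residues`), hence `Frame.colorable_four` (g10's `colorable_four_of_cube_steps`);
* `colorable_two_of_one_steps` — the BIPARTITE colouring lemma: steps of norm one and residue one give a
  `2`-colourable graph; the ramified frames (`c₂ = −3`, where every step has residue one) are treated in
  `TwoAdicFramesRamified`.

No residue field is named; nothing here is literature (printed special cases: Woodall 1973 `χ(ℚ²) = 2`, Johnson 1987
`χ(ℚ(√n)²) = 2` for `n ≡ 1, 2 (mod 4)`, Madore 2015 Prop. 3.6 `χ(ℚ₂(√2)²) = 2` — all quadratic; see the global file).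
-/

noncomputable section

namespace Summit.Ventures.DiscreteObjects.UnitDistance.MoserLocal

open Spectral SimpleGraph

variable {Ω : Type*} [Field Ω] [CharZero Ω] [Algebra ℚ_[2] Ω] [Algebra.IsAlgebraic ℚ_[2] Ω]

/-- A STEP FRAME of the local data `D`: generators `g₁ ∈ ℚ₂(s2, I)` (fixed by `τ`) and `g₂` (`g₂² = c₂ ∈ ℚ₂`,
negated by `τ`), and a `ℚ₂`-automorphism `α` with `α I = −I` fixing `g₁, g₂` (complex conjugation over `ℚ₂(g₁, g₂)`). -/
structure LocalData23.Frame (D : LocalData23 Ω) where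
  /-- first generator (`s2` or `I·s2`) -/
  g₁ : Ω
  /-- second generator (`s3` or `I·s3`) -/
  g₂ : Ω
  /-- the square of `g₂` (`3` or `−3`) -/
  c₂ : ℚ_[2]
  /-- the conjugation of the frame: negates `I`, fixes `g₁, g₂` -/
  α : Ω ≃ₐ[ℚ_[2]] Ω
  /-- `g₁ ∈ ℚ₂ ⊕ ℚ₂ s2 ⊕ ℚ₂ I ⊕ ℚ₂ s2 I` -/
  g₁_inV8 : D.InV8 g₁
  /-- `g₂ ^ 2 = c₂` -/
  g₂_sq : g₂ ^ 2 = algebraMap ℚ_[2] Ω c₂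
  /-- `α I = -I` -/
  αI : α D.I = -D.I
  /-- `α g₁ = g₁` -/
  αg₁ : α g₁ = g₁
  /-- `α g₂ = g₂` -/
  αg₂ : α g₂ = g₂
  /-- `τ g₁ = g₁` -/
  τg₁ : D.τ g₁ = g₁
  /-- `τ g₂ = -g₂` -/
  τg₂ : D.τ g₂ = -g₂

variable {D : LocalData23 Ω} (F : D.Frame)

/-- The STEPS of the frame: `u = (A + B g₂) + I (C + E g₂)` with `A, B, C, E ∈ ℚ₂ ⊕ ℚ₂ g₁` and
`(A + B g₂)² + (C + E g₂)² = 1` (differences of adjacent vertices of a unit-distance graph over `ℚ(√d : [d] ∈ ⟨[g₁²],[c₂]⟩)`). -/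
def LocalData23.Frame.steps : Set Ω :=
  {u | ∃ a b c d e f g h : ℚ_[2],
    u = ((algebraMap ℚ_[2] Ω a + algebraMap ℚ_[2] Ω b * F.g₁) + (algebraMap ℚ_[2] Ω c + algebraMap ℚ_[2] Ω d * F.g₁) * F.g₂)
      + D.I * ((algebraMap ℚ_[2] Ω e + algebraMap ℚ_[2] Ω f * F.g₁) + (algebraMap ℚ_[2] Ω g + algebraMap ℚ_[2] Ω h * F.g₁) * F.g₂) ∧
    ((algebraMap ℚ_[2] Ω a + algebraMap ℚ_[2] Ω b * F.g₁) + (algebraMap ℚ_[2] Ω c + algebraMap ℚ_[2] Ω d * F.g₁) * F.g₂) ^ 2 +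
      ((algebraMap ℚ_[2] Ω e + algebraMap ℚ_[2] Ω f * F.g₁) + (algebraMap ℚ_[2] Ω g + algebraMap ℚ_[2] Ω h * F.g₁) * F.g₂) ^ 2 = 1}

omit [CharZero Ω] [Algebra.IsAlgebraic ℚ_[2] Ω] in
/-- `α` fixes `a + b g₁`. -/
theorem LocalData23.Frame.α_pair (a b : ℚ_[2]) :
    F.α (algebraMap ℚ_[2] Ω a + algebraMap ℚ_[2] Ω b * F.g₁) = algebraMap ℚ_[2] Ω a + algebraMap ℚ_[2] Ω b * F.g₁ := by
  rw [map_add, map_mul, F.α.commutes, F.α.commutes, F.αg₁]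

omit [CharZero Ω] [Algebra.IsAlgebraic ℚ_[2] Ω] in
/-- `τ` fixes `a + b g₁`. -/
theorem LocalData23.Frame.τ_pair (a b : ℚ_[2]) :
    D.τ (algebraMap ℚ_[2] Ω a + algebraMap ℚ_[2] Ω b * F.g₁) = algebraMap ℚ_[2] Ω a + algebraMap ℚ_[2] Ω b * F.g₁ := by
  rw [map_add, map_mul, D.τ.commutes, D.τ.commutes, F.τg₁]

omit [CharZero Ω] [Algebra.IsAlgebraic ℚ_[2] Ω] in
/-- THE HERMITIAN IDENTITY: a frame step satisfies `u · αu = 1` (`αu = X − I·Y`). -/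
theorem LocalData23.Frame.mul_α_eq_one {u : Ω} (hu : u ∈ F.steps) : u * F.α u = 1 := by
  obtain ⟨a, b, c, d, e, f, g, h, rfl, hq⟩ := hu
  set A := algebraMap ℚ_[2] Ω a + algebraMap ℚ_[2] Ω b * F.g₁ with hA
  set B := algebraMap ℚ_[2] Ω c + algebraMap ℚ_[2] Ω d * F.g₁ with hB
  set C := algebraMap ℚ_[2] Ω e + algebraMap ℚ_[2] Ω f * F.g₁ with hC
  set E := algebraMap ℚ_[2] Ω g + algebraMap ℚ_[2] Ω h * F.g₁ with hE
  have hα : F.α ((A + B * F.g₂) + D.I * (C + E * F.g₂)) = (A + B * F.g₂) - D.I * (C + E * F.g₂) := by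
    simp only [hA, hB, hC, hE, map_add, map_mul, AlgEquiv.commutes, F.αI, F.αg₁, F.αg₂]
    ring
  rw [hα]; linear_combination hq + (-((C + E * F.g₂) ^ 2)) * D.hI

omit [CharZero Ω] in
/-- A frame step has spectral norm `1` (`u·αu = 1` and `‖αu‖ = ‖u‖`). -/
theorem LocalData23.Frame.spN_step {u : Ω} (hu : u ∈ F.steps) : spN ℚ_[2] u = 1 := by
  have hn := congrArg (spN ℚ_[2]) (F.mul_α_eq_one hu)
  rw [spN_mul, spN_aut, spN_one] at hn
  have h0 := spN_nonneg ℚ_[2] u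
  nlinarith [hn, h0]

omit [CharZero Ω] in
/-- A frame step lies in the unit ball. -/
theorem LocalData23.Frame.step_mem_ball {u : Ω} (hu : u ∈ F.steps) : u ∈ ball ℚ_[2] Ω := by
  rw [mem_ball_iff, F.spN_step hu]

/-- CUBE LEMMA: the residue of a frame step is a cube root of unity (`T = u + τu` and `N = u·τu` lie in
`ℚ₂(s2, I)`, whose unit-ball residues are `0` or `1`). -/
theorem LocalData23.Frame.resid_step_cube {u : Ω} (hu : u ∈ F.steps) :
    resid ℚ_[2] Ω ⟨u, F.step_mem_ball hu⟩ ^ 3 = 1 := by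
  have hmem := F.step_mem_ball hu
  have hnu := F.spN_step hu
  obtain ⟨a, b, c, d, e, f, g, h, hu_eq, hq⟩ := hu
  set A := algebraMap ℚ_[2] Ω a + algebraMap ℚ_[2] Ω b * F.g₁ with hA
  set B := algebraMap ℚ_[2] Ω c + algebraMap ℚ_[2] Ω d * F.g₁ with hB
  set C := algebraMap ℚ_[2] Ω e + algebraMap ℚ_[2] Ω f * F.g₁ with hC
  set E := algebraMap ℚ_[2] Ω g + algebraMap ℚ_[2] Ω h * F.g₁ with hE
  have hpairV : ∀ x y : ℚ_[2], D.InV8 (algebraMap ℚ_[2] Ω x + algebraMap ℚ_[2] Ω y * F.g₁) := by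
    intro x y
    have hx : D.InV8 (algebraMap ℚ_[2] Ω x) := by
      have := D.inV8_pair x 0
      rwa [map_zero, zero_mul, add_zero] at this
    have hy : D.InV8 (algebraMap ℚ_[2] Ω y) := by
      have := D.inV8_pair y 0
      rwa [map_zero, zero_mul, add_zero] at this
    exact hx.add (hy.mul F.g₁_inV8)
  have hAv : D.InV8 A := hpairV a b
  have hBv : D.InV8 B := hpairV c d
  have hCv : D.InV8 C := hpairV e f
  have hEv : D.InV8 E := hpairV g h
  have hcv : D.InV8 (algebraMap ℚ_[2] Ω F.c₂) := by
    have := D.inV8_pair F.c₂ 0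
    rwa [map_zero, zero_mul, add_zero] at this
  -- τ u
  have hτu : D.τ u = (A - B * F.g₂) + D.I * (C - E * F.g₂) := by
    rw [hu_eq]
    simp only [hA, hB, hC, hE, map_add, map_mul, AlgEquiv.commutes, D.τI, F.τg₁, F.τg₂]
    ring
  set T : Ω := u + D.τ u with hT
  set N : Ω := u * D.τ u with hN
  have hT_eq : T = (A + A) + D.I * (C + C) := by rw [hT, hτu, hu_eq]; ring
  have hN_eq : N = (A * A - algebraMap ℚ_[2] Ω F.c₂ * (B * B)) +
      D.I * ((A * C + A * C) - algebraMap ℚ_[2] Ω F.c₂ * (B * E + B * E)) +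
      D.I * D.I * (C * C - algebraMap ℚ_[2] Ω F.c₂ * (E * E)) := by
    rw [hN, hτu, hu_eq]; linear_combination (-(B ^ 2) - 2 * D.I * B * E - D.I ^ 2 * E ^ 2) * F.g₂_sq
  have hTv : D.InV8 T := by rw [hT_eq]; exact (hAv.add hAv).add (D.inV8_I.mul (hCv.add hCv))
  have hNv : D.InV8 N := by
    rw [hN_eq]
    exact (((hAv.mul hAv).sub (hcv.mul (hBv.mul hBv))).add
      (D.inV8_I.mul (((hAv.mul hCv).add (hAv.mul hCv)).sub (hcv.mul ((hBv.mul hEv).add (hBv.mul hEv)))))).add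
      ((D.inV8_I.mul D.inV8_I).mul ((hCv.mul hCv).sub (hcv.mul (hEv.mul hEv))))
  have hnτ : spN ℚ_[2] (D.τ u) = 1 := by rw [spN_aut]; exact hnu
  have hT_le : spN ℚ_[2] T ≤ 1 := by rw [hT]; exact (spN_add_le ℚ_[2] _ _).trans (max_le hnu.le hnτ.le)
  have hN_one : spN ℚ_[2] N = 1 := by rw [hN, spN_mul, hnu, hnτ, mul_one]
  have hTmem : T ∈ ball ℚ_[2] Ω := hT_le
  have hNmem : N ∈ ball ℚ_[2] Ω := by rw [mem_ball_iff, hN_one]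
  set ub : ball ℚ_[2] Ω := ⟨u, hmem⟩ with hub
  set Tb : ball ℚ_[2] Ω := ⟨T, hTmem⟩ with hTb
  set Nb : ball ℚ_[2] Ω := ⟨N, hNmem⟩ with hNb
  have hrel : ub ^ 2 - Tb * ub + Nb = 0 := by
    apply Subtype.ext
    change u ^ 2 - T * u + N = (0 : Ω)
    rw [hT, hN]; ring
  have hT01 := hTv.resid_zero_or_one hTmem
  have hN01 := hNv.resid_zero_or_one hNmem
  have hN_ne : resid ℚ_[2] Ω Nb ≠ 0 := resid_ne_zero_of_spN_eq_one ℚ_[2] hN_one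
  have hN1 : resid ℚ_[2] Ω Nb = 1 := by
    rcases hN01 with h0 | h1
    · exact absurd h0 hN_ne
    · exact h1
  have key := congrArg (resid ℚ_[2] Ω) hrel
  rw [map_add, map_sub, map_mul, map_pow, map_zero, hN1] at key
  set x := resid ℚ_[2] Ω ub with hx
  rcases hT01 with h0 | h1
  · rw [h0, zero_mul, sub_zero] at key
    have hsq : (x + 1) ^ 2 = 0 := by
      have : (x + 1) ^ 2 = x ^ 2 + 1 + 2 * x := by ring
      rw [this, key, two_eq_zero_resid, zero_mul, add_zero]
    have hx1 : x + 1 = 0 := pow_eq_zero_iff (by norm_num) |>.1 hsq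
    have hx' : x = 1 := by
      have := eq_neg_of_add_eq_zero_left hx1
      rw [this, neg_eq_self_resid]
    rw [hx', one_pow]
  · rw [h1, one_mul] at key
    have h3 : x ^ 3 + 1 = (x + 1) * (x ^ 2 - x + 1) := by ring
    rw [key, mul_zero] at h3
    rw [eq_neg_of_add_eq_zero_left h3, neg_eq_self_resid]

/-- FOUR COLOURS in every frame: labels with frame-step differences give a `4`-colourable graph. -/
theorem LocalData23.Frame.colorable_four {V : Type*} {G : SimpleGraph V} (z : V → Ω)
    (hz : ∀ ⦃v w : V⦄, G.Adj v w → z v - z w ∈ F.steps) : G.Colorable 4 :=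
  colorable_four_of_cube_steps F.steps (fun _ hu => F.spN_step hu) (fun _ hu => F.resid_step_cube hu) z hz

/-! ## Two colours from steps of residue one -/

omit [CharZero Ω] in
/-- BIPARTITE COLOURING LEMMA: if every edge difference of the labelling `z` lies in a set `S` of norm-one elements
with residue `1`, the graph is `2`-colourable (residues of centred labels are `0` or `1`; adjacent ones differ by `1`). -/
theorem colorable_two_of_one_steps (S : Set Ω) (hS1 : ∀ u ∈ S, spN ℚ_[2] u = 1)
    (hS : ∀ u (hu : u ∈ S), resid ℚ_[2] Ω ⟨u, by rw [mem_ball_iff, hS1 u hu]⟩ = 1)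
    {V : Type*} {G : SimpleGraph V} (z : V → Ω) (hz : ∀ ⦃v w : V⦄, G.Adj v w → z v - z w ∈ S) :
    G.Colorable 2 := by
  classical
  -- along walks: differences in the ball with residue `0` or `1`
  have hwalk : ∀ {x y : V} (p : G.Walk x y),
      ∃ h : z y - z x ∈ ball ℚ_[2] Ω, (resid ℚ_[2] Ω ⟨z y - z x, h⟩ = 0 ∨ resid ℚ_[2] Ω ⟨z y - z x, h⟩ = 1) := by
    intro x y p
    induction p with
    | @nil x =>
      have h0 : z x - z x ∈ ball ℚ_[2] Ω := by rw [sub_self]; exact (ball ℚ_[2] Ω).zero_mem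
      refine ⟨h0, Or.inl ?_⟩
      have : (⟨z x - z x, h0⟩ : ball ℚ_[2] Ω) = 0 := Subtype.ext (sub_self _)
      rw [this, map_zero]
    | @cons a b c hab p ih =>
      obtain ⟨hbc, hcol⟩ := ih
      have hu : z b - z a ∈ S := hz (G.adj_symm hab)
      have hub : z b - z a ∈ ball ℚ_[2] Ω := by rw [mem_ball_iff, hS1 _ hu]
      have hsum : z c - z a = (z c - z b) + (z b - z a) := by ring
      have hmem : z c - z a ∈ ball ℚ_[2] Ω := by rw [hsum]; exact (ball ℚ_[2] Ω).add_mem hbc hub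
      refine ⟨hmem, ?_⟩
      have : (⟨z c - z a, hmem⟩ : ball ℚ_[2] Ω) = ⟨z c - z b, hbc⟩ + ⟨z b - z a, hub⟩ := Subtype.ext hsum
      rw [this, map_add, hS _ hu]
      rcases hcol with h0 | h1
      · right; rw [h0, zero_add]
      · left; rw [h1, ← two_mul, mul_one]; exact two_eq_zero_resid
  have hbase : ∀ v, ∃ h : z v - z (baseVertex G v) ∈ ball ℚ_[2] Ω,
      (resid ℚ_[2] Ω ⟨z v - z (baseVertex G v), h⟩ = 0 ∨ resid ℚ_[2] Ω ⟨z v - z (baseVertex G v), h⟩ = 1) := fun v => by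
    obtain ⟨p⟩ := baseVertex_reachable G v
    exact hwalk p
  let c : V → Fin 2 := fun v => if resid ℚ_[2] Ω ⟨z v - z (baseVertex G v), (hbase v).1⟩ = 0 then 0 else 1
  have hvalid : ∀ {v w : V}, G.Adj v w → c v ≠ c w := by
    intro v w hvw hcvw
    have hb : baseVertex G w = baseVertex G v := (baseVertex_eq_of_adj hvw).symm
    -- equal colours force equal residues
    have heq : resid ℚ_[2] Ω ⟨z v - z (baseVertex G v), (hbase v).1⟩ =
        resid ℚ_[2] Ω ⟨z w - z (baseVertex G w), (hbase w).1⟩ := by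
      by_cases hv0 : resid ℚ_[2] Ω ⟨z v - z (baseVertex G v), (hbase v).1⟩ = 0
      · by_cases hw0 : resid ℚ_[2] Ω ⟨z w - z (baseVertex G w), (hbase w).1⟩ = 0
        · rw [hv0, hw0]
        · exfalso
          have : c v = 0 := by simp only [c, hv0, if_true]
          have : c w = 1 := by simp only [c, hw0, if_false]
          simp_all
      · by_cases hw0 : resid ℚ_[2] Ω ⟨z w - z (baseVertex G w), (hbase w).1⟩ = 0
        · exfalso
          have : c v = 1 := by simp only [c, hv0, if_false]
          have : c w = 0 := by simp only [c, hw0, if_true]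
          simp_all
        · rw [(hbase v).2.resolve_left hv0, (hbase w).2.resolve_left hw0]
    rw [resid_eq_iff] at heq
    have hdiff : (z v - z (baseVertex G v)) - (z w - z (baseVertex G w)) = z v - z w := by rw [hb]; ring
    have hlt : spN ℚ_[2] (z v - z w) < 1 := by
      have := heq
      simp only at this
      rwa [hdiff] at this
    rw [hS1 _ (hz hvw)] at hlt
    exact lt_irrefl _ hlt
  exact (Coloring.mk c hvalid).colorable

end Summit.Ventures.DiscreteObjects.UnitDistance.MoserLocal
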